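import Summits.NavierStokesRegularity.NavierStokesRegularity.Theorems.PoloidalWindowDoorPoloidalWindowRigidityZShockLoadedCharacteristics
import HarnessLib

/-!
# Crux K2 `PoloidalWindowRigidity` (stmt-NavierStokesRegularity-19708), line `z_shock` — the x-PERIODIC residual of R2 without sign
# hypothesis: recurrence along characteristics and threading of the inflection set

`--supports stmt-NavierStokesRegularity-19708 --as helper` (leafhand-ns-poloidalwindowdoor-3 g3, cell decomp-ns, 2026-08-31).  Class-free,
Mathlib + tree files only.  **No stub and no summit is closed by this file; Navier–Stokes regularity is NOT proved here (rung 0).**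

After p823407–p824267 the census item «R2 with sign-changing `κ'`» is reduced to persistently interacting data, whose model is the
`x`-PERIODIC two-sided solution (Klainerman–Majda's setting, large data).  For such solutions of the autonomous p-system
`p_z = −κ(w)² w_x`, `w_z = −p_x` on `ℝ × ℝ` (`(w, p)(z, x + P) = (w, p)(z, x)`, `0 < κlo ≤ κ(w) ≤ κhi`, `κ > 0`, `K' = κ`):

* `periodic_recur_down` / `periodic_recur_up` — ★ RECURRENCE: along every forward characteristic `X`, the state `(w, p)(z, X z)` is
  re-attained at a height `t ∈ [z − P/(2κlo), z − P/(2κhi)]` below and at a height `t ∈ [z + P/(2κhi), z + P/(2κlo)]` above.  (Crossing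
  identity: the backward characteristic through `(z, X z)` meets the shifted forward characteristic `X ± P` there, `s` is constant along
  it, `r` is constant along `X`, and `s`, `r` are `P`-periodic.)  Hence every value of `(w, p) ∘ X` recurs in every height window of
  length `P/(2κlo)` (`periodic_recur_window_up/down`).
* `periodic_loaded_char_meets_inflection` — ★ THREADING: if moreover `(w, p) ∈ C²`, `κ ∈ C¹` with `|κ'(w)| ≤ k₁`, `|w_x| ≤ W₁`, then
  along every LOADED forward characteristic (`p_x + κ(w) w_x ≠ 0` somewhere on it) `w` takes an inflection value: `κ'(w(t, X t)) = 0`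
  for some `t` — with NO sign hypothesis.  (Otherwise `κ'(w ∘ X)` has one strict sign, bounded away from `0` by recurrence + compactness of
  a window, contradicting `…LoadedCharacteristics.loaded_char_not_eventually_pos/neg`.)  For genuinely nonlinear `κ` (`κ' ≠ 0`) this
  re-proves the periodic two-sided Liouville theorem; for sign-changing `κ'` it is the first rigorous constraint on the periodic residual:
  a non-constant periodic two-sided solution threads the inflection set `{κ' = 0}` on every loaded characteristic, in every height window.
[folklore] (method of characteristics; Glimm–Lax 1970, Klainerman–Majda 1980 for the forward-in-time theory)
-/

noncomputable section

namespace Summit.NavierStokesRegularity.NavierStokesRegularity.Theorems.PoloidalWindowDoorPoloidalWindowRigidityZShockPeriodicRecurrence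

-- the summit and its single sub-problem share the name (CONVENTIONS §1)
set_option linter.dupNamespace false

open Set Filter Topology Function Metric
open Summit.NavierStokesRegularity.NavierStokesRegularity.Theorems.PoloidalWindowDoorPoloidalWindowRigidityZShockPSystemNonuniform
open Summit.NavierStokesRegularity.NavierStokesRegularity.Theorems.PoloidalWindowDoorPoloidalWindowRigidityZShockScalarEternal
open Summit.NavierStokesRegularity.NavierStokesRegularity.Theorems.PoloidalWindowDoorPoloidalWindowRigidityZShockCompactDisturbance
open Summit.NavierStokesRegularity.NavierStokesRegularity.Theorems.PoloidalWindowDoorPoloidalWindowRigidityZShockQuietTools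
open Summit.NavierStokesRegularity.NavierStokesRegularity.Theorems.PoloidalWindowDoorPoloidalWindowRigidityZShockLoadedCharacteristics

variable {w p : ℝ × ℝ → ℝ} {κ κ' K : ℝ → ℝ} {κlo κhi k₁ W₁ P : ℝ} {X : ℝ → ℝ}

/-- **One recurrence step downward.**  Periodic two-sided solution, forward characteristic `X`: the state at height `z` is re-attained
on `X` at a height `t ∈ [z − P/(2κlo), z − P/(2κhi)]`. [folklore] -/
theorem periodic_recur_down (hw : Differentiable ℝ w) (hp : Differentiable ℝ p)
    (hKd : ∀ v, HasDerivAt K (κ v) v) (hκd : ∀ v, HasDerivAt κ (κ' v) v)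
    (hsys1 : ∀ q, fderiv ℝ p q (1, 0) = -(κ (w q) ^ 2 * fderiv ℝ w q (0, 1)))
    (hsys2 : ∀ q, fderiv ℝ w q (1, 0) = -fderiv ℝ p q (0, 1))
    (hκlo0 : 0 < κlo) (hκlo : ∀ q, κlo ≤ κ (w q)) (hκhi : ∀ q, κ (w q) ≤ κhi) (hκpos : ∀ v, 0 < κ v)
    (hk₁ : ∀ q, |κ' (w q)| ≤ k₁) (hW₁ : ∀ q, |fderiv ℝ w q (0, 1)| ≤ W₁)
    (hP : 0 < P) (hPw : ∀ z x, w (z, x + P) = w (z, x)) (hPp : ∀ z x, p (z, x + P) = p (z, x))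
    (hX : ∀ z, HasDerivAt X (κ (w (z, X z))) z) (z : ℝ) :
    ∃ t : ℝ, z - P / (2 * κlo) ≤ t ∧ t ≤ z - P / (2 * κhi) ∧ w (t, X t) = w (z, X z) ∧ p (t, X t) = p (z, X z) := by
  have hκhi0 : 0 < κhi := hκlo0.trans_le ((hκlo (0, 0)).trans (hκhi (0, 0)))
  have hKmono : StrictMono K := strictMono_of_deriv_pos fun v => by rw [(hKd v).deriv]; exact hκpos v
  have hκB : ∀ q, |κ (w q)| ≤ κhi := fun q => by rw [abs_of_pos (hκpos _)]; exact hκhi q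
  -- Riemann invariants, transport equations
  set r : ℝ × ℝ → ℝ := fun q => p q + K (w q) with hrdef
  set s : ℝ × ℝ → ℝ := fun q => p q - K (w q) with hsdef
  have hKw : ∀ q, HasFDerivAt (fun q' => K (w q')) (κ (w q) • fderiv ℝ w q) q :=
    fun q => (hKd (w q)).comp_hasFDerivAt q (hw q).hasFDerivAt
  have hrF : ∀ q, HasFDerivAt r (fderiv ℝ p q + κ (w q) • fderiv ℝ w q) q := fun q => (hp q).hasFDerivAt.add (hKw q)
  have hsF : ∀ q, HasFDerivAt s (fderiv ℝ p q - κ (w q) • fderiv ℝ w q) q := fun q => (hp q).hasFDerivAt.sub (hKw q)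
  have hr1 : Differentiable ℝ r := fun q => (hrF q).differentiableAt
  have hs1 : Differentiable ℝ s := fun q => (hsF q).differentiableAt
  have hrD : ∀ q v, fderiv ℝ r q v = fderiv ℝ p q v + κ (w q) * fderiv ℝ w q v := by
    intro q v; rw [(hrF q).fderiv]; simp [smul_eq_mul]
  have hsD : ∀ q v, fderiv ℝ s q v = fderiv ℝ p q v - κ (w q) * fderiv ℝ w q v := by
    intro q v; rw [(hsF q).fderiv]; simp [smul_eq_mul]
  have hPDE1 : ∀ q, fderiv ℝ r q (1, 0) + (fun q => κ (w q)) q * fderiv ℝ r q (0, 1) = 0 := by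
    intro q; simp only; rw [hrD, hrD, hsys1, hsys2]; ring
  have hPDE2 : ∀ q, fderiv ℝ s q (1, 0) + (fun q => -κ (w q)) q * fderiv ℝ s q (0, 1) = 0 := by
    intro q; simp only; rw [hsD, hsD, hsys1, hsys2]; ring
  have hκd' : ∀ v, HasDerivAt (fun v => -κ v) ((fun v => -κ' v) v) v := fun v => (hκd v).neg
  have hκB' : ∀ q, |(fun v => -κ v) (w q)| ≤ κhi := fun q => by simp only [abs_neg]; exact hκB q
  have hk₁' : ∀ q, |(fun v => -κ' v) (w q)| ≤ k₁ := fun q => by simp only [abs_neg]; exact hk₁ q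
  -- the shifted forward characteristic and the backward characteristic through `(z, X z)`
  have hX1 : ∀ t, HasDerivAt (fun t => X t + P) (κ (w (t, X t + P))) t := fun t => by
    rw [hPw]; exact (hX t).add_const P
  obtain ⟨Y, hY0, hY⟩ := exists_global_char (c := fun v => -κ v) hw hκd' hκB' hk₁' hW₁ z (X z)
  set D : ℝ → ℝ := fun t => (X t + P) - Y t with hD
  have hDd : ∀ t, HasDerivAt D (κ (w (t, X t + P)) - -κ (w (t, Y t))) t := fun t => (hX1 t).sub (hY t)
  have hDc : Continuous D := continuous_iff_continuousAt.2 fun t => (hDd t).continuousAt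
  have hDz : D z = P := by simp only [hD, hY0]; ring
  set t₁ : ℝ := z - P / (2 * κlo) with ht₁
  set t₂ : ℝ := z - P / (2 * κhi) with ht₂
  have ht₁₂ : t₁ ≤ t₂ := by
    have : P / (2 * κhi) ≤ P / (2 * κlo) := div_le_div_of_nonneg_left hP.le (by positivity) (by linarith [(hκlo (0,0)).trans (hκhi (0,0))])
    rw [ht₁, ht₂]; linarith
  have ht₂z : t₂ < z := by have : 0 < P / (2 * κhi) := by positivity
                           rw [ht₂]; linarith
  have ht₁z : t₁ < z := lt_of_le_of_lt ht₁₂ ht₂z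
  have hDt₁ : D t₁ ≤ 0 := by
    have h := slope_ge_of_deriv_ge (b₀ := 2 * κlo) hDd ht₁z (fun t _ => by linarith [hκlo (t, X t + P), hκlo (t, Y t)])
    have h2 : 2 * κlo * (z - t₁) = P := by rw [ht₁]; field_simp; ring
    rw [hDz] at h; linarith
  have hDt₂ : 0 ≤ D t₂ := by
    have h := slope_ge_of_deriv_ge (ψ := fun t => -D t) (β := fun t => -(κ (w (t, X t + P)) - -κ (w (t, Y t))))
      (b₀ := -(2 * κhi)) (fun t => (hDd t).neg) ht₂z (fun t _ => by linarith [hκhi (t, X t + P), hκhi (t, Y t)])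
    have h2 : 2 * κhi * (z - t₂) = P := by rw [ht₂]; field_simp; ring
    rw [hDz] at h; linarith
  obtain ⟨t, ht, hDt⟩ : ∃ t ∈ Icc t₁ t₂, D t = 0 :=
    intermediate_value_Icc ht₁₂ hDc.continuousOn ⟨hDt₁, hDt₂⟩
  have hmeet : Y t = X t + P := by simp only [hD] at hDt; linarith
  -- `s` along `Y`, periodicity, `r` along `X`
  have hs : s (z, X z) = s (t, X t) := by
    have h := const_along (c := fun q => -κ (w q)) hs1 hPDE2 hY z t
    rw [hY0, hmeet] at h
    rw [h]; simp only [hsdef, hPw, hPp]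
  have hr : r (z, X z) = r (t, X t) := const_along (c := fun q => κ (w q)) hr1 hPDE1 hX z t
  simp only [hrdef, hsdef] at hs hr
  refine ⟨t, by rw [ht₁] at ht; exact ht.1, by rw [ht₂] at ht; exact ht.2, ?_, by linarith⟩
  exact hKmono.injective (by linarith)

/-- **One recurrence step upward**: the state at height `z` is re-attained on `X` at a height `t ∈ [z + P/(2κhi), z + P/(2κlo)]`
(the backward characteristic through `(z, X z)`, run upward, meets `X − P`). [folklore] -/
theorem periodic_recur_up (hw : Differentiable ℝ w) (hp : Differentiable ℝ p)
    (hKd : ∀ v, HasDerivAt K (κ v) v) (hκd : ∀ v, HasDerivAt κ (κ' v) v)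
    (hsys1 : ∀ q, fderiv ℝ p q (1, 0) = -(κ (w q) ^ 2 * fderiv ℝ w q (0, 1)))
    (hsys2 : ∀ q, fderiv ℝ w q (1, 0) = -fderiv ℝ p q (0, 1))
    (hκlo0 : 0 < κlo) (hκlo : ∀ q, κlo ≤ κ (w q)) (hκhi : ∀ q, κ (w q) ≤ κhi) (hκpos : ∀ v, 0 < κ v)
    (hk₁ : ∀ q, |κ' (w q)| ≤ k₁) (hW₁ : ∀ q, |fderiv ℝ w q (0, 1)| ≤ W₁)
    (hP : 0 < P) (hPw : ∀ z x, w (z, x + P) = w (z, x)) (hPp : ∀ z x, p (z, x + P) = p (z, x))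
    (hX : ∀ z, HasDerivAt X (κ (w (z, X z))) z) (z : ℝ) :
    ∃ t : ℝ, z + P / (2 * κhi) ≤ t ∧ t ≤ z + P / (2 * κlo) ∧ w (t, X t) = w (z, X z) ∧ p (t, X t) = p (z, X z) := by
  have hκhi0 : 0 < κhi := hκlo0.trans_le ((hκlo (0, 0)).trans (hκhi (0, 0)))
  have hKmono : StrictMono K := strictMono_of_deriv_pos fun v => by rw [(hKd v).deriv]; exact hκpos v
  have hκB : ∀ q, |κ (w q)| ≤ κhi := fun q => by rw [abs_of_pos (hκpos _)]; exact hκhi q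
  have hPw' : ∀ z x, w (z, x - P) = w (z, x) := fun z x => by rw [← hPw z (x - P), sub_add_cancel]
  have hPp' : ∀ z x, p (z, x - P) = p (z, x) := fun z x => by rw [← hPp z (x - P), sub_add_cancel]
  set r : ℝ × ℝ → ℝ := fun q => p q + K (w q) with hrdef
  set s : ℝ × ℝ → ℝ := fun q => p q - K (w q) with hsdef
  have hKw : ∀ q, HasFDerivAt (fun q' => K (w q')) (κ (w q) • fderiv ℝ w q) q :=
    fun q => (hKd (w q)).comp_hasFDerivAt q (hw q).hasFDerivAt
  have hrF : ∀ q, HasFDerivAt r (fderiv ℝ p q + κ (w q) • fderiv ℝ w q) q := fun q => (hp q).hasFDerivAt.add (hKw q)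
  have hsF : ∀ q, HasFDerivAt s (fderiv ℝ p q - κ (w q) • fderiv ℝ w q) q := fun q => (hp q).hasFDerivAt.sub (hKw q)
  have hr1 : Differentiable ℝ r := fun q => (hrF q).differentiableAt
  have hs1 : Differentiable ℝ s := fun q => (hsF q).differentiableAt
  have hrD : ∀ q v, fderiv ℝ r q v = fderiv ℝ p q v + κ (w q) * fderiv ℝ w q v := by
    intro q v; rw [(hrF q).fderiv]; simp [smul_eq_mul]
  have hsD : ∀ q v, fderiv ℝ s q v = fderiv ℝ p q v - κ (w q) * fderiv ℝ w q v := by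
    intro q v; rw [(hsF q).fderiv]; simp [smul_eq_mul]
  have hPDE1 : ∀ q, fderiv ℝ r q (1, 0) + (fun q => κ (w q)) q * fderiv ℝ r q (0, 1) = 0 := by
    intro q; simp only; rw [hrD, hrD, hsys1, hsys2]; ring
  have hPDE2 : ∀ q, fderiv ℝ s q (1, 0) + (fun q => -κ (w q)) q * fderiv ℝ s q (0, 1) = 0 := by
    intro q; simp only; rw [hsD, hsD, hsys1, hsys2]; ring
  have hκd' : ∀ v, HasDerivAt (fun v => -κ v) ((fun v => -κ' v) v) v := fun v => (hκd v).neg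
  have hκB' : ∀ q, |(fun v => -κ v) (w q)| ≤ κhi := fun q => by simp only [abs_neg]; exact hκB q
  have hk₁' : ∀ q, |(fun v => -κ' v) (w q)| ≤ k₁ := fun q => by simp only [abs_neg]; exact hk₁ q
  have hX1 : ∀ t, HasDerivAt (fun t => X t - P) (κ (w (t, X t - P))) t := fun t => by
    rw [hPw']; exact (hX t).sub_const P
  obtain ⟨Y, hY0, hY⟩ := exists_global_char (c := fun v => -κ v) hw hκd' hκB' hk₁' hW₁ z (X z)
  set E : ℝ → ℝ := fun t => (X t - P) - Y t with hE
  have hEd : ∀ t, HasDerivAt E (κ (w (t, X t - P)) - -κ (w (t, Y t))) t := fun t => (hX1 t).sub (hY t)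
  have hEc : Continuous E := continuous_iff_continuousAt.2 fun t => (hEd t).continuousAt
  have hEz : E z = -P := by simp only [hE, hY0]; ring
  set t₁ : ℝ := z + P / (2 * κhi) with ht₁
  set t₂ : ℝ := z + P / (2 * κlo) with ht₂
  have ht₁₂ : t₁ ≤ t₂ := by
    have : P / (2 * κhi) ≤ P / (2 * κlo) := div_le_div_of_nonneg_left hP.le (by positivity) (by linarith [(hκlo (0,0)).trans (hκhi (0,0))])
    rw [ht₁, ht₂]; linarith
  have hzt₁ : z < t₁ := by have : 0 < P / (2 * κhi) := by positivity
                           rw [ht₁]; linarith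
  have hzt₂ : z < t₂ := lt_of_lt_of_le hzt₁ ht₁₂
  have hEt₁ : E t₁ ≤ 0 := by
    have h := slope_ge_of_deriv_ge (ψ := fun t => -E t) (β := fun t => -(κ (w (t, X t - P)) - -κ (w (t, Y t))))
      (b₀ := -(2 * κhi)) (fun t => (hEd t).neg) hzt₁ (fun t _ => by linarith [hκhi (t, X t - P), hκhi (t, Y t)])
    have h2 : 2 * κhi * (t₁ - z) = P := by rw [ht₁]; field_simp; ring
    rw [hEz] at h; linarith
  have hEt₂ : 0 ≤ E t₂ := by
    have h := slope_ge_of_deriv_ge (b₀ := 2 * κlo) hEd hzt₂ (fun t _ => by linarith [hκlo (t, X t - P), hκlo (t, Y t)])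
    have h2 : 2 * κlo * (t₂ - z) = P := by rw [ht₂]; field_simp; ring
    rw [hEz] at h; linarith
  obtain ⟨t, ht, hEt⟩ : ∃ t ∈ Icc t₁ t₂, E t = 0 :=
    intermediate_value_Icc ht₁₂ hEc.continuousOn ⟨hEt₁, hEt₂⟩
  have hmeet : Y t = X t - P := by simp only [hE] at hEt; linarith
  have hs : s (z, X z) = s (t, X t) := by
    have h := const_along (c := fun q => -κ (w q)) hs1 hPDE2 hY z t
    rw [hY0, hmeet] at h
    rw [h]; simp only [hsdef, hPw', hPp']
  have hr : r (z, X z) = r (t, X t) := const_along (c := fun q => κ (w q)) hr1 hPDE1 hX z t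
  simp only [hrdef, hsdef] at hs hr
  refine ⟨t, by rw [ht₁] at ht; exact ht.1, by rw [ht₂] at ht; exact ht.2, ?_, by linarith⟩
  exact hKmono.injective (by linarith)

/-- **Window recurrence upward**: for `z ≤ T` the state `(w, p)(z, X z)` is re-attained on `X` at a height in `[T, T + P/(2κlo)]`.
[folklore] -/
theorem periodic_recur_window_up (hw : Differentiable ℝ w) (hp : Differentiable ℝ p)
    (hKd : ∀ v, HasDerivAt K (κ v) v) (hκd : ∀ v, HasDerivAt κ (κ' v) v)
    (hsys1 : ∀ q, fderiv ℝ p q (1, 0) = -(κ (w q) ^ 2 * fderiv ℝ w q (0, 1)))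
    (hsys2 : ∀ q, fderiv ℝ w q (1, 0) = -fderiv ℝ p q (0, 1))
    (hκlo0 : 0 < κlo) (hκlo : ∀ q, κlo ≤ κ (w q)) (hκhi : ∀ q, κ (w q) ≤ κhi) (hκpos : ∀ v, 0 < κ v)
    (hk₁ : ∀ q, |κ' (w q)| ≤ k₁) (hW₁ : ∀ q, |fderiv ℝ w q (0, 1)| ≤ W₁)
    (hP : 0 < P) (hPw : ∀ z x, w (z, x + P) = w (z, x)) (hPp : ∀ z x, p (z, x + P) = p (z, x))
    (hX : ∀ z, HasDerivAt X (κ (w (z, X z))) z) {z T : ℝ} (hzT : z ≤ T) :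
    ∃ t : ℝ, T ≤ t ∧ t ≤ T + P / (2 * κlo) ∧ w (t, X t) = w (z, X z) ∧ p (t, X t) = p (z, X z) := by
  classical
  have hκhi0 : 0 < κhi := hκlo0.trans_le ((hκlo (0, 0)).trans (hκhi (0, 0)))
  choose f hf1 hf2 hfw hfp using
    fun z' => periodic_recur_up hw hp hKd hκd hsys1 hsys2 hκlo0 hκlo hκhi hκpos hk₁ hW₁ hP hPw hPp hX z'
  have ha : 0 < P / (2 * κhi) := by positivity
  have hb : 0 < P / (2 * κlo) := by positivity
  set seq : ℕ → ℝ := fun n => f^[n] z with hseq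
  have hsucc : ∀ n, seq (n + 1) = f (seq n) := fun n => Function.iterate_succ_apply' f n z
  have hgrow : ∀ n : ℕ, z + n * (P / (2 * κhi)) ≤ seq n := by
    intro n
    induction n with
    | zero => simp [hseq]
    | succ n ih => rw [hsucc]; have := hf1 (seq n); push_cast; linarith
  have hvals : ∀ n, w (seq n, X (seq n)) = w (z, X z) ∧ p (seq n, X (seq n)) = p (z, X z) := by
    intro n
    induction n with
    | zero => simp [hseq]
    | succ n ih => rw [hsucc]; exact ⟨(hfw _).trans ih.1, (hfp _).trans ih.2⟩
  have hex : ∃ n : ℕ, T ≤ seq n := by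
    obtain ⟨n, hn⟩ := exists_nat_gt ((T - z) / (P / (2 * κhi)))
    refine ⟨n, ?_⟩
    rw [div_lt_iff₀ ha] at hn
    linarith [hgrow n]
  obtain ⟨m, hm⟩ : ∃ m, Nat.find hex = m := ⟨_, rfl⟩
  have hmspec : T ≤ seq m := hm ▸ Nat.find_spec hex
  rcases Nat.eq_zero_or_pos m with h0 | hpos
  · have hz : seq m = z := by rw [h0]; simp [hseq]
    refine ⟨z, by linarith [hz ▸ hmspec], by linarith, rfl, rfl⟩
  · obtain ⟨m', rfl⟩ : ∃ m', m = m' + 1 := ⟨m - 1, (Nat.sub_add_cancel hpos).symm⟩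
    have hprev : ¬ T ≤ seq m' := Nat.find_min hex (by rw [hm]; exact Nat.lt_succ_self m')
    refine ⟨seq (m' + 1), hmspec, ?_, (hvals _).1, (hvals _).2⟩
    rw [hsucc]
    linarith [hf2 (seq m'), not_le.1 hprev]

/-- **Window recurrence downward**: for `T ≤ z` the state `(w, p)(z, X z)` is re-attained on `X` at a height in `[T − P/(2κlo), T]`.
[folklore] -/
theorem periodic_recur_window_down (hw : Differentiable ℝ w) (hp : Differentiable ℝ p)
    (hKd : ∀ v, HasDerivAt K (κ v) v) (hκd : ∀ v, HasDerivAt κ (κ' v) v)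
    (hsys1 : ∀ q, fderiv ℝ p q (1, 0) = -(κ (w q) ^ 2 * fderiv ℝ w q (0, 1)))
    (hsys2 : ∀ q, fderiv ℝ w q (1, 0) = -fderiv ℝ p q (0, 1))
    (hκlo0 : 0 < κlo) (hκlo : ∀ q, κlo ≤ κ (w q)) (hκhi : ∀ q, κ (w q) ≤ κhi) (hκpos : ∀ v, 0 < κ v)
    (hk₁ : ∀ q, |κ' (w q)| ≤ k₁) (hW₁ : ∀ q, |fderiv ℝ w q (0, 1)| ≤ W₁)
    (hP : 0 < P) (hPw : ∀ z x, w (z, x + P) = w (z, x)) (hPp : ∀ z x, p (z, x + P) = p (z, x))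
    (hX : ∀ z, HasDerivAt X (κ (w (z, X z))) z) {z T : ℝ} (hTz : T ≤ z) :
    ∃ t : ℝ, T - P / (2 * κlo) ≤ t ∧ t ≤ T ∧ w (t, X t) = w (z, X z) ∧ p (t, X t) = p (z, X z) := by
  classical
  have hκhi0 : 0 < κhi := hκlo0.trans_le ((hκlo (0, 0)).trans (hκhi (0, 0)))
  choose f hf1 hf2 hfw hfp using
    fun z' => periodic_recur_down hw hp hKd hκd hsys1 hsys2 hκlo0 hκlo hκhi hκpos hk₁ hW₁ hP hPw hPp hX z'
  have ha : 0 < P / (2 * κhi) := by positivity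
  have hb : 0 < P / (2 * κlo) := by positivity
  set seq : ℕ → ℝ := fun n => f^[n] z with hseq
  have hsucc : ∀ n, seq (n + 1) = f (seq n) := fun n => Function.iterate_succ_apply' f n z
  have hdrop : ∀ n : ℕ, seq n ≤ z - n * (P / (2 * κhi)) := by
    intro n
    induction n with
    | zero => simp [hseq]
    | succ n ih => rw [hsucc]; have := hf2 (seq n); push_cast; linarith
  have hvals : ∀ n, w (seq n, X (seq n)) = w (z, X z) ∧ p (seq n, X (seq n)) = p (z, X z) := by
    intro n
    induction n with
    | zero => simp [hseq]
    | succ n ih => rw [hsucc]; exact ⟨(hfw _).trans ih.1, (hfp _).trans ih.2⟩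
  have hex : ∃ n : ℕ, seq n ≤ T := by
    obtain ⟨n, hn⟩ := exists_nat_gt ((z - T) / (P / (2 * κhi)))
    refine ⟨n, ?_⟩
    rw [div_lt_iff₀ ha] at hn
    linarith [hdrop n]
  obtain ⟨m, hm⟩ : ∃ m, Nat.find hex = m := ⟨_, rfl⟩
  have hmspec : seq m ≤ T := hm ▸ Nat.find_spec hex
  rcases Nat.eq_zero_or_pos m with h0 | hpos
  · have hz : seq m = z := by rw [h0]; simp [hseq]
    refine ⟨z, by linarith, by linarith [hz ▸ hmspec], rfl, rfl⟩
  · obtain ⟨m', rfl⟩ : ∃ m', m = m' + 1 := ⟨m - 1, (Nat.sub_add_cancel hpos).symm⟩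
    have hprev : ¬ seq m' ≤ T := Nat.find_min hex (by rw [hm]; exact Nat.lt_succ_self m')
    refine ⟨seq (m' + 1), ?_, hmspec, (hvals _).1, (hvals _).2⟩
    rw [hsucc]
    linarith [hf1 (seq m'), not_le.1 hprev]

/-- **★ Threading of the inflection set.**  Periodic two-sided `C²` solution, `κ ∈ C¹` (NO sign hypothesis): along every LOADED forward
characteristic `w` takes a value where `κ'` vanishes. [folklore] -/
theorem periodic_loaded_char_meets_inflection (hw : ContDiff ℝ 2 w) (hp : ContDiff ℝ 2 p)
    (hK2 : ContDiff ℝ 2 K) (hKd : ∀ v, HasDerivAt K (κ v) v) (hκd : ∀ v, HasDerivAt κ (κ' v) v) (hκ'c : Continuous κ')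
    (hsys1 : ∀ q, fderiv ℝ p q (1, 0) = -(κ (w q) ^ 2 * fderiv ℝ w q (0, 1)))
    (hsys2 : ∀ q, fderiv ℝ w q (1, 0) = -fderiv ℝ p q (0, 1))
    (hκlo0 : 0 < κlo) (hκlo : ∀ q, κlo ≤ κ (w q)) (hκhi : ∀ q, κ (w q) ≤ κhi) (hκpos : ∀ v, 0 < κ v)
    (hk₁ : ∀ q, |κ' (w q)| ≤ k₁) (hW₁ : ∀ q, |fderiv ℝ w q (0, 1)| ≤ W₁)
    (hP : 0 < P) (hPw : ∀ z x, w (z, x + P) = w (z, x)) (hPp : ∀ z x, p (z, x + P) = p (z, x))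
    (hX : ∀ z, HasDerivAt X (κ (w (z, X z))) z) {z₀ : ℝ}
    (h0 : fderiv ℝ p (z₀, X z₀) (0, 1) + κ (w (z₀, X z₀)) * fderiv ℝ w (z₀, X z₀) (0, 1) ≠ 0) :
    ∃ t : ℝ, κ' (w (t, X t)) = 0 := by
  have hw1 : Differentiable ℝ w := hw.differentiable (by simp)
  have hp1 : Differentiable ℝ p := hp.differentiable (by simp)
  by_contra hnone
  push Not at hnone
  set b : ℝ := P / (2 * κlo) with hb
  have hb0 : 0 < b := by rw [hb]; positivity
  -- `φ = κ' ∘ w ∘ X` is continuous and never zero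
  set φ : ℝ → ℝ := fun t => κ' (w (t, X t)) with hφ
  have hXc : Continuous X := continuous_iff_continuousAt.2 fun t => (hX t).continuousAt
  have hφc : Continuous φ := hκ'c.comp (hw1.continuous.comp (continuous_id.prodMk hXc))
  -- every value of `w ∘ X` is attained in the window `[-b, b]`
  have hwin : ∀ t, ∃ t' ∈ Icc (-b) b, w (t', X t') = w (t, X t) := by
    intro t
    rcases le_total t 0 with ht | ht
    · obtain ⟨t', h1, h2, h3, -⟩ := periodic_recur_window_up hw1 hp1 hKd hκd hsys1 hsys2 hκlo0 hκlo hκhi hκpos hk₁ hW₁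
        hP hPw hPp hX (z := t) (T := 0) ht
      exact ⟨t', ⟨by linarith, by rw [hb]; linarith⟩, h3⟩
    · obtain ⟨t', h1, h2, h3, -⟩ := periodic_recur_window_down hw1 hp1 hKd hκd hsys1 hsys2 hκlo0 hκlo hκhi hκpos hk₁ hW₁
        hP hPw hPp hX (z := t) (T := 0) ht
      exact ⟨t', ⟨by rw [hb]; linarith, by linarith⟩, h3⟩
  -- minimum of `|φ|` on the window
  obtain ⟨tm, htm, hmin⟩ := (isCompact_Icc (a := -b) (b := b)).exists_isMinOn (nonempty_Icc.2 (by linarith))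
    (hφc.abs.continuousOn)
  set ε : ℝ := |φ tm| with hε
  have hεpos : 0 < ε := abs_pos.2 (hnone tm)
  have hge : ∀ t, ε ≤ |φ t| := by
    intro t
    obtain ⟨t', ht', hwt⟩ := hwin t
    have h : |φ tm| ≤ |φ t'| := hmin ht'
    have e : φ t' = φ t := by simp only [hφ, hwt]
    rw [hε, ← e]; exact h
  rcases lt_or_gt_of_ne (hnone z₀) with hneg | hpos
  · -- `φ < 0` everywhere, `≤ -ε`
    have hall : ∀ t, φ t ≤ -ε := by
      intro t
      have hsame := mul_pos_of_ne_zero hφc hnone t z₀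
      have ht : φ t < 0 := by nlinarith
      have := hge t
      rw [abs_of_neg ht] at this
      linarith
    exact loaded_char_not_eventually_neg hw hp hK2 hKd hκd hsys1 hsys2 hκpos hκhi hk₁ hW₁ hX h0 hεpos
      (T := 0) (S := 0) (fun t _ => hall t) (fun t _ => hall t)
  · have hall : ∀ t, ε ≤ φ t := by
      intro t
      have hsame := mul_pos_of_ne_zero hφc hnone t z₀
      have ht : 0 < φ t := by nlinarith
      have := hge t
      rwa [abs_of_pos ht] at this
    exact loaded_char_not_eventually_pos hw hp hK2 hKd hκd hsys1 hsys2 hκpos hκhi hk₁ hW₁ hX h0 hεpos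
      (T := 0) (S := 0) (fun t _ => hall t) (fun t _ => hall t)

/-- **★ Threading in every height window.**  Under the hypotheses of `periodic_loaded_char_meets_inflection`, along a loaded forward
characteristic `w` takes an inflection value in EVERY height window `[T − P/(2κlo), T + P/(2κlo)]` (threading + window recurrence).
[folklore] -/
theorem periodic_loaded_char_meets_inflection_window (hw : ContDiff ℝ 2 w) (hp : ContDiff ℝ 2 p)
    (hK2 : ContDiff ℝ 2 K) (hKd : ∀ v, HasDerivAt K (κ v) v) (hκd : ∀ v, HasDerivAt κ (κ' v) v) (hκ'c : Continuous κ')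
    (hsys1 : ∀ q, fderiv ℝ p q (1, 0) = -(κ (w q) ^ 2 * fderiv ℝ w q (0, 1)))
    (hsys2 : ∀ q, fderiv ℝ w q (1, 0) = -fderiv ℝ p q (0, 1))
    (hκlo0 : 0 < κlo) (hκlo : ∀ q, κlo ≤ κ (w q)) (hκhi : ∀ q, κ (w q) ≤ κhi) (hκpos : ∀ v, 0 < κ v)
    (hk₁ : ∀ q, |κ' (w q)| ≤ k₁) (hW₁ : ∀ q, |fderiv ℝ w q (0, 1)| ≤ W₁)
    (hP : 0 < P) (hPw : ∀ z x, w (z, x + P) = w (z, x)) (hPp : ∀ z x, p (z, x + P) = p (z, x))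
    (hX : ∀ z, HasDerivAt X (κ (w (z, X z))) z) {z₀ : ℝ}
    (h0 : fderiv ℝ p (z₀, X z₀) (0, 1) + κ (w (z₀, X z₀)) * fderiv ℝ w (z₀, X z₀) (0, 1) ≠ 0) (T : ℝ) :
    ∃ t ∈ Icc (T - P / (2 * κlo)) (T + P / (2 * κlo)), κ' (w (t, X t)) = 0 := by
  have hw1 : Differentiable ℝ w := hw.differentiable (by simp)
  have hp1 : Differentiable ℝ p := hp.differentiable (by simp)
  have hb : 0 < P / (2 * κlo) := by positivity
  obtain ⟨t₀, ht₀⟩ := periodic_loaded_char_meets_inflection hw hp hK2 hKd hκd hκ'c hsys1 hsys2 hκlo0 hκlo hκhi hκpos hk₁ hW₁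
    hP hPw hPp hX h0
  rcases le_total t₀ T with hle | hle
  · obtain ⟨t, h1, h2, h3, -⟩ := periodic_recur_window_up hw1 hp1 hKd hκd hsys1 hsys2 hκlo0 hκlo hκhi hκpos hk₁ hW₁
      hP hPw hPp hX hle
    exact ⟨t, ⟨by linarith, h2⟩, by rw [h3]; exact ht₀⟩
  · obtain ⟨t, h1, h2, h3, -⟩ := periodic_recur_window_down hw1 hp1 hKd hκd hsys1 hsys2 hκlo0 hκlo hκhi hκpos hk₁ hW₁
      hP hPw hPp hX hle
    exact ⟨t, ⟨h1, by linarith⟩, by rw [h3]; exact ht₀⟩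

end Summit.NavierStokesRegularity.NavierStokesRegularity.Theorems.PoloidalWindowDoorPoloidalWindowRigidityZShockPeriodicRecurrence

end
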